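import Literature.Computability.QuantumComplexity.MagicSemiring
import HarnessLib

/-!
# The magic semiring `MagicClass`: the quotient and its commutative semiring structure

Topic `Literature/Computability/QuantumComplexity`; definition request `defn-MagicClass` (route
QuantumAdvantage/MagicSpectrum). Sequel to `MagicSemiring.lean`, which builds the formal sums
`PreMagic` of multi-qubit state vectors, their (noncommutative-on-the-nose) semiring structure and
the derivability relation `PreMagic.Derives X Y` ("`X ≽ Y`": `Y` is obtained from `X` by Clifford
circuits, rescaling, ancillas, `⟨0|`-projections, merging and discarding zeros, in `⊕`/`⊗`
contexts), with the preorder `X ≤ Y :⟺ Y ≽ X`. Here: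

* **`MagicClass := Antisymmetrization PreMagic (· ≤ ·)`** — formal sums modulo mutual
  derivability (Zuiddam 2018, §2.3: "We identify any `s, t ∈ S` for which `s ⩽ t` and `t ⩽ s`"),
  a partial order; `MagicClass.le = (· ≤ ·)` as a named relation (the argument of
  `IsStrassenPreorder`, `rankOf`, `IsSpectralPoint` of `StrassenPreorder.lean`);
* `MagicClass.ofPre : PreMagic → MagicClass` (a surjective semiring homomorphism, `ofPreHom`) and
  `MagicClass.mk ψ = [ψ]`, the class of a single `n`-qubit vector;
* **`instance : CommSemiring MagicClass`** — `⊕`, `⊗` descend (derivability is closed under both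
  contexts), all axioms but commutativity of `⊗` already hold for formal sums, and
  `X ⊗ Y ≽ Y ⊗ X` by Clifford SWAP networks (`PreMagic.Derives.comm`);
* the generators at class level: `mk (C ψ) ≤ mk ψ` (Clifford), `mk (c • ψ) ≤ mk ψ`,
  `mk (ψ ⊗ |0⟩) ≤ mk ψ`, `mk (x ↦ ψ (x, 0)) ≤ mk ψ`, `mk (ψ + φ) ≤ mk ψ + mk φ` (merging),
  `mk (x ↦ ψ (x ∘ π)) ≤ mk ψ`, and `mk ψ * mk φ = mk (ψ ⊗ φ)`, `1 = mk 1₀`, `mk 0ₙ = 0`.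

The Strassen-preorder axioms for `MagicClass.le`, the dictionary "spectral points ↔ functionals
`F n ψ` with the axioms (A0)–(A8) of route MagicSpectrum", and `rankOf le (mk ψ) = stabilizerRank ψ`
are the subject of the sequels.

## References

* J. Zuiddam, PhD thesis (2018), Ch. 2, §2.3 (preordered semirings; the quotient by the
  equivalence generated by the preorder). [Zuiddam2018]
* V. Strassen, J. reine angew. Math. 384 (1988), §2. [Strassen1988]
* S. Bravyi, G. Smith, J. A. Smolin, Phys. Rev. X 6 (2016) 021043, §I, §IV. [BravyiSmithSmolin2016]
* S. Aaronson, D. Gottesman, Phys. Rev. A 70 (2004) 052328, §III. [AaronsonGottesman2004]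
-/

noncomputable section

namespace Literature.Computability.QuantumComplexity

open Cryptography Matrix PreMagic

/-! ## The quotient -/

/-- **The magic semiring `MagicClass`**: formal sums of multi-qubit states modulo mutual
derivability, partially ordered by `x ≤ y :⟺` "`x` is derivable from `y`". [cite: Zuiddam2018, §2.3] -/
abbrev MagicClass : Type := Antisymmetrization PreMagic (· ≤ ·)

namespace MagicClass

/-- The class of a formal sum. [cite: Zuiddam2018, §2.3] -/
def ofPre : PreMagic → MagicClass := toAntisymmetrization (· ≤ ·)

/-- The class `[ψ]` of a single `n`-qubit vector. [cite: Zuiddam2018, §2.3] -/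
def mk {n : ℕ} (ψ : QReg n → ℂ) : MagicClass := ofPre (single ⟨n, ψ⟩)

/-- The order of the magic semiring as a named relation (`le x y ↔ x ≤ y ↔` `x` derivable from `y`),
the argument expected by `IsStrassenPreorder`, `rankOf`, `IsSpectralPoint`. [cite: Zuiddam2018, §2.3] -/
abbrev le : MagicClass → MagicClass → Prop := (· ≤ ·)

/-- Every class is the class of a formal sum. [folklore] -/
theorem ind {p : MagicClass → Prop} (h : ∀ X : PreMagic, p (ofPre X)) (x : MagicClass) : p x :=
  Antisymmetrization.ind _ h x

/-- `ofPre X ≤ ofPre Y ↔ Y ≽ X`. [cite: Zuiddam2018, §2.3] -/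
theorem ofPre_le_ofPre {X Y : PreMagic} : ofPre X ≤ ofPre Y ↔ Derives Y X := Iff.rfl

/-- Mutually derivable formal sums have the same class. [cite: Zuiddam2018, §2.3] -/
theorem sound {X Y : PreMagic} (h₁ : Derives X Y) (h₂ : Derives Y X) : ofPre X = ofPre Y :=
  Quotient.sound ⟨h₂, h₁⟩

/-- `ofPre X = ofPre Y ↔` mutual derivability. [cite: Zuiddam2018, §2.3] -/
theorem ofPre_eq_ofPre {X Y : PreMagic} : ofPre X = ofPre Y ↔ Derives X Y ∧ Derives Y X := by
  constructor
  · intro h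
    exact ⟨(le_antisymm_iff.1 h).2, (le_antisymm_iff.1 h).1⟩
  · exact fun h => sound h.1 h.2

/-- Addition of classes. [cite: Zuiddam2018, §2.3] -/
instance : Add MagicClass :=
  ⟨Quotient.map₂ (· + ·) fun _ _ hX _ _ hY => ⟨hX.1.add hY.1, hX.2.add hY.2⟩⟩

/-- Multiplication of classes. [cite: Zuiddam2018, §2.3] -/
instance : Mul MagicClass :=
  ⟨Quotient.map₂ (· * ·) fun _ _ hX _ _ hY => ⟨hX.1.mul hY.1, hX.2.mul hY.2⟩⟩

/-- `0 = [∅]`. [cite: Zuiddam2018, §2.3] -/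
instance : Zero MagicClass := ⟨ofPre 0⟩

/-- `1 = [{⟨0, 1⟩}]`. [cite: Zuiddam2018, §2.3] -/
instance : One MagicClass := ⟨ofPre 1⟩

/-- `ofPre` is additive (by definition). [folklore] -/
theorem ofPre_add (X Y : PreMagic) : ofPre (X + Y) = ofPre X + ofPre Y := rfl

/-- `ofPre` is multiplicative (by definition). [folklore] -/
theorem ofPre_mul (X Y : PreMagic) : ofPre (X * Y) = ofPre X * ofPre Y := rfl

/-- `ofPre 0 = 0`. [folklore] -/
theorem ofPre_zero : ofPre 0 = (0 : MagicClass) := rfl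

/-- `ofPre 1 = 1`. [folklore] -/
theorem ofPre_one : ofPre 1 = (1 : MagicClass) := rfl

/-- **The magic semiring is a commutative semiring.** All axioms but commutativity of `⊗` hold
already for formal sums; `X ⊗ Y ≽ Y ⊗ X ≽ X ⊗ Y` by Clifford SWAP networks (`Derives.comm`).
[cite: Zuiddam2018, §2.3] -/
instance : CommSemiring MagicClass where
  add_assoc x y z := by
    induction x using ind with | _ X =>
    induction y using ind with | _ Y =>
    induction z using ind with | _ Z =>
    rw [← ofPre_add, ← ofPre_add, ← ofPre_add, ← ofPre_add, add_assoc]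
  zero_add x := by
    induction x using ind with | _ X =>
    rw [← ofPre_zero, ← ofPre_add, zero_add]
  add_zero x := by
    induction x using ind with | _ X =>
    rw [← ofPre_zero, ← ofPre_add, add_zero]
  add_comm x y := by
    induction x using ind with | _ X =>
    induction y using ind with | _ Y =>
    rw [← ofPre_add, ← ofPre_add, add_comm]
  left_distrib x y z := by
    induction x using ind with | _ X =>
    induction y using ind with | _ Y =>
    induction z using ind with | _ Z =>
    rw [← ofPre_add, ← ofPre_mul, ← ofPre_mul, ← ofPre_mul, ← ofPre_add, left_distrib]
  right_distrib x y z := by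
    induction x using ind with | _ X =>
    induction y using ind with | _ Y =>
    induction z using ind with | _ Z =>
    rw [← ofPre_add, ← ofPre_mul, ← ofPre_mul, ← ofPre_mul, ← ofPre_add, right_distrib]
  zero_mul x := by
    induction x using ind with | _ X =>
    rw [← ofPre_zero, ← ofPre_mul, zero_mul]
  mul_zero x := by
    induction x using ind with | _ X =>
    rw [← ofPre_zero, ← ofPre_mul, mul_zero]
  mul_assoc x y z := by
    induction x using ind with | _ X =>
    induction y using ind with | _ Y =>
    induction z using ind with | _ Z =>
    rw [← ofPre_mul, ← ofPre_mul, ← ofPre_mul, ← ofPre_mul, mul_assoc]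
  one_mul x := by
    induction x using ind with | _ X =>
    rw [← ofPre_one, ← ofPre_mul, one_mul]
  mul_one x := by
    induction x using ind with | _ X =>
    rw [← ofPre_one, ← ofPre_mul, mul_one]
  mul_comm x y := by
    induction x using ind with | _ X =>
    induction y using ind with | _ Y =>
    rw [← ofPre_mul, ← ofPre_mul]
    exact sound (Derives.comm X Y) (Derives.comm Y X)
  natCast n := ofPre n
  natCast_zero := by change ofPre ((0 : ℕ) : PreMagic) = ofPre 0; rw [Nat.cast_zero]
  natCast_succ n := by
    change ofPre ((n + 1 : ℕ) : PreMagic) = ofPre n + ofPre 1; rw [Nat.cast_succ, ofPre_add]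
  nsmul := nsmulRec
  npow := npowRec

/-- `ofPre` commutes with natural-number literals: `(n : MagicClass) = ofPre n`. [folklore] -/
theorem ofPre_natCast (n : ℕ) : ofPre (n : PreMagic) = (n : MagicClass) := rfl

/-- `ofPre` as a bundled semiring homomorphism `PreMagic →+* MagicClass`. [cite: Zuiddam2018, §2.3] -/
def ofPreHom : PreMagic →+* MagicClass where
  toFun := ofPre
  map_one' := ofPre_one
  map_mul' := ofPre_mul
  map_zero' := ofPre_zero
  map_add' := ofPre_add

/-- `ofPreHom X = ofPre X`. [folklore] -/
@[simp] theorem ofPreHom_apply (X : PreMagic) : ofPreHom X = ofPre X := rfl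

/-- `ofPre` commutes with powers. [folklore] -/
theorem ofPre_pow (X : PreMagic) (N : ℕ) : ofPre (X ^ N) = ofPre X ^ N :=
  map_pow ofPreHom X N

/-- `ofPre` commutes with multiset sums. [folklore] -/
theorem ofPre_multiset_sum (M : Multiset PreMagic) : ofPre M.sum = (M.map ofPre).sum := by
  rw [← ofPreHom_apply, map_multiset_sum, Multiset.map_congr rfl fun x _ => ofPreHom_apply x]

/-- `ofPre` is monotone for `≽` read backwards: `X ≽ Y → ofPre Y ≤ ofPre X`. [cite: Zuiddam2018, §2.3] -/
theorem ofPre_le_of_derives {X Y : PreMagic} (h : Derives X Y) : ofPre Y ≤ ofPre X := h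

/-! ### Classes of single states -/

variable {n a b : ℕ}

/-- `mk ψ = ofPre {⟨n, ψ⟩}` (by definition). [folklore] -/
theorem mk_def (ψ : QReg n → ℂ) : mk ψ = ofPre (single ⟨n, ψ⟩) := rfl

/-- **`[ψ] · [φ] = [ψ ⊗ φ]`.** [cite: BravyiSmithSmolin2016, §IV eq. (9)] -/
theorem mk_mul_mk (ψ : QReg a → ℂ) (φ : QReg b → ℂ) : mk ψ * mk φ = mk (tensorVec ψ φ) := by
  rw [mk_def, mk_def, ← ofPre_mul, single_mul_single]; rfl

/-- **`1 = [1₀]`**, the class of the amplitude `1` on zero qubits. [cite: Zuiddam2018, §2.3] -/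
theorem one_eq_mk : (1 : MagicClass) = mk (fun _ : QReg 0 => (1 : ℂ)) := rfl

/-- **`[0ₙ] = 0`**: a zero vector is nothing. [cite: BravyiSmithSmolin2016, §I] -/
theorem mk_zero (n : ℕ) : mk (0 : QReg n → ℂ) = 0 :=
  sound (Derives.discard n) (Derives.create n)

/-- `[ψ] ≤ [φ]` from a derivation `{φ} ≽ {ψ}`. [cite: Zuiddam2018, §2.3] -/
theorem mk_le_mk_of_derives {ψ : QReg a → ℂ} {φ : QReg b → ℂ}
    (h : Derives (single ⟨b, φ⟩) (single ⟨a, ψ⟩)) : mk ψ ≤ mk φ := h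

/-- **Clifford circuits are free**: `[C ψ] ≤ [ψ]`. [cite: BravyiSmithSmolin2016, §I] -/
theorem mk_clifford_le {C : Matrix (QReg n) (QReg n) ℂ} (hC : C ∈ cliffordCircuits n)
    (ψ : QReg n → ℂ) : mk (C *ᵥ ψ) ≤ mk ψ :=
  Derives.clifford hC ψ

/-- **Rescaling is free**: `[c • ψ] ≤ [ψ]`. [cite: BravyiSmithSmolin2016, §I] -/
theorem mk_smul_le (c : ℂ) (ψ : QReg n → ℂ) : mk (c • ψ) ≤ mk ψ :=
  Derives.smul c ψ

/-- **Ancillas are free**: `[ψ ⊗ |0⟩] ≤ [ψ]`. [cite: BravyiSmithSmolin2016, §I] -/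
theorem mk_ancilla_le (ψ : QReg n → ℂ) : mk (tensorVec ψ (zeroState 1)) ≤ mk ψ :=
  Derives.ancilla ψ

/-- **Projections are free**: `[x ↦ ψ (x, 0)] ≤ [ψ]`. [cite: AaronsonGottesman2004, §III] -/
theorem mk_proj_le (ψ : QReg (n + 1) → ℂ) : mk (fun x => ψ (Fin.snoc x false)) ≤ mk ψ :=
  Derives.proj ψ

/-- **Merging**: `[ψ + φ] ≤ [ψ] + [φ]`. [cite: BravyiSmithSmolin2016, §I] -/
theorem mk_add_le (ψ φ : QReg n → ℂ) : mk (ψ + φ) ≤ mk ψ + mk φ :=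
  Derives.merge ψ φ

/-- **Wire permutations are free**: `[x ↦ ψ (x ∘ π)] ≤ [ψ]`. [cite: NielsenChuang2010, §1.3.4] -/
theorem mk_perm_le (π : Equiv.Perm (Fin n)) (ψ : QReg n → ℂ) : mk (fun x => ψ (x ∘ π)) ≤ mk ψ :=
  Derives.perm π ψ

end MagicClass

end Literature.Computability.QuantumComplexity

end
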